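import Mathlib.MeasureTheory.Integral.Bochner.Basic
import Mathlib.MeasureTheory.Integral.IntegrableOn
import Mathlib.MeasureTheory.Measure.Real
import Mathlib.Algebra.Order.Floor.Semiring
import HarnessLib

/-!
# Extending a decorrelation bound from indicators to bounded functions

Topic `Literature/Probability/Moments` (kind proof; no new notions).  A standard measure-theoretic
bookkeeping step of cluster / mixing estimates: a bilinear DECORRELATION BOUND for two decorated events,

  `|E[H 𝟙_T(U) · H' 𝟙_{T'}(U')] − E[H 𝟙_T(U)] E[H' 𝟙_{T'}(U')]| ≤ ζ · ν(T) · ν(T')`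

for all measurable `T, T'` (`U, U'` two random elements of a measurable space carrying a reference
measure `ν`, `H, H'` bounded weights, `ζ` the mixing coefficient — e.g. a truncated two-point
correlation bound at a given scale), extends to bounded measurable functions `f, f'` of `U, U'`
supported in `D, D'`:

  `|E[H f(U) · H' f'(U')] − E[H f(U)] E[H' f'(U')]| ≤ ζ · ‖f‖_∞ ‖f'‖_∞ · ν(D) ν(D')`

(`abs_integral_mul_sub_le_of_indicator`, for `f, f' ≥ 0`; the covariance forms, including signed
`f, f'` with a factor `4`, are in `DecorrelationExtensionCovariance.lean`).  Proof: quantise `f` from below at resolution `‖f‖_∞/n` — a DISCRETE LAYER-CAKE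
formula `f_n = Σ_{m<n} (‖f‖_∞/n) 𝟙{f ≥ (m+1)‖f‖_∞/n}` with super-level sets inside the support
(`sum_range_ite_le`), expand bilinearly (finite sums, no Fubini), bound each of the `n²` terms by the
hypothesis, and let `n → ∞` (the quantisation error is `O(1/n)` uniformly).  This is how mixing
coefficients defined on events (`α`-mixing, Rosenblatt 1956) control covariances of bounded
functionals (Davydov's / Ibragimov's covariance inequality in its bounded case, Doukhan 1994 §1.2.2
Thm 3 with `p = q = ∞`).

## Mathlib

We USE `Nat.floor` (`Nat.floor_le`, `Nat.lt_floor_add_one`, `Nat.le_floor_iff`),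
`MeasureTheory.integral_finsetSum`, `norm_integral_le_of_norm_le_const`, `measureReal_mono`,
`ProbabilityTheory.covariance_eq_sub` and the bilinearity lemmas `covariance_sub_left/right`.
Mathlib has no mixing coefficients and no covariance inequality of this type (searched `mixing`,
`covariance_le`, `abs_covariance`).

## References

* P. Doukhan, *Mixing: Properties and Examples*, LNS 85, Springer 1994, §1.2.2.  [folklore]
* M. Rosenblatt, *A central limit theorem and a strong mixing condition*, PNAS 42 (1956) 43–47.
  [folklore]
-/

noncomputable section

open MeasureTheory ProbabilityTheory

namespace Literature.Probability.Moments

/-! ## The discrete layer-cake quantisation -/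

/-- **Discrete layer cake.**  For `0 ≤ y ≤ n δ` (`δ > 0`) the sum of `δ` over the levels
`(m + 1) δ ≤ y`, `m < n`, equals `δ ⌊y/δ⌋` and hence lies in `[y − δ, y]`. [folklore] -/
theorem sum_range_ite_le {y δ : ℝ} (hδ : 0 < δ) (hy : 0 ≤ y) {n : ℕ} (hyn : y ≤ n * δ) :
    y - δ ≤ (∑ m ∈ Finset.range n, if ((m : ℝ) + 1) * δ ≤ y then δ else 0) ∧
      (∑ m ∈ Finset.range n, if ((m : ℝ) + 1) * δ ≤ y then δ else 0) ≤ y := by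
  set K : ℕ := ⌊y / δ⌋₊ with hK
  have hKy : (K : ℝ) ≤ y / δ := Nat.floor_le (div_nonneg hy hδ.le)
  have hyK : y / δ < K + 1 := Nat.lt_floor_add_one _
  have hKn : K ≤ n := by
    by_contra h
    have h1 : (n : ℝ) + 1 ≤ K := by exact_mod_cast Nat.lt_iff_add_one_le.1 (not_le.1 h)
    have h2 : y / δ ≤ n := by rw [div_le_iff₀ hδ]; exact hyn
    linarith
  have hiff : ∀ m : ℕ, ((m : ℝ) + 1) * δ ≤ y ↔ m < K := by
    intro m
    rw [← le_div_iff₀ hδ, show ((m : ℝ) + 1) = ((m + 1 : ℕ) : ℝ) by push_cast; ring,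
      ← Nat.le_floor_iff (div_nonneg hy hδ.le), ← hK]
    omega
  have hsum : (∑ m ∈ Finset.range n, if ((m : ℝ) + 1) * δ ≤ y then δ else 0) = K * δ := by
    rw [Finset.sum_congr rfl fun m _ => if_congr (hiff m) rfl rfl, ← Finset.sum_filter]
    have hfil : (Finset.range n).filter (fun m => m < K) = Finset.range K := by
      ext m
      simp only [Finset.mem_filter, Finset.mem_range]
      omega
    rw [hfil, Finset.sum_const, Finset.card_range, nsmul_eq_mul]
  rw [hsum]
  constructor
  · have : y < (K + 1) * δ := by rwa [← div_lt_iff₀ hδ]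
    linarith
  · rwa [← le_div_iff₀ hδ]

/-! ## From indicators to bounded functions -/

section Extension

variable {Ω α : Type*} [MeasurableSpace Ω] [MeasurableSpace α]
  (P : Measure Ω) [IsFiniteMeasure P] (ν : Measure α) [IsFiniteMeasure ν]

/-- A bounded measurable real function has `|∫ g dP| ≤ C · P(Ω)`. [folklore] -/
theorem abs_integral_le_mul_measureReal {g : Ω → ℝ} {C : ℝ} (hg : ∀ ω, |g ω| ≤ C) :
    |∫ ω, g ω ∂P| ≤ C * P.real Set.univ := by
  have h := norm_integral_le_of_norm_le_const (μ := P) (f := g) (C := C)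
    (ae_of_all _ fun ω => by rw [Real.norm_eq_abs]; exact hg ω)
  rwa [Real.norm_eq_abs] at h

/-- `|a b − a' b'| ≤ |a − a'| |b| + |a'| |b − b'|`. [folklore] -/
theorem abs_mul_sub_mul_le (a b a' b' : ℝ) : |a * b - a' * b'| ≤ |a - a'| * |b| + |a'| * |b - b'| := by
  rw [show a * b - a' * b' = (a - a') * b + a' * (b - b') by ring]
  exact (abs_add_le _ _).trans (by rw [abs_mul, abs_mul])

/-- If `a ≤ b + c/n` for all `n ≥ 1` (`c ≥ 0`) then `a ≤ b`. [folklore] -/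
theorem le_of_forall_le_add_div {a b c : ℝ} (hc : 0 ≤ c) (h : ∀ n : ℕ, 1 ≤ n → a ≤ b + c / n) :
    a ≤ b := by
  refine le_of_forall_pos_le_add fun ε hε => ?_
  obtain ⟨n, hn⟩ := exists_nat_gt (c / ε)
  have hn1 : 1 ≤ n := by
    rcases Nat.eq_zero_or_pos n with h0 | hpos
    · subst h0; simp at hn; linarith [div_nonneg hc hε.le]
    · exact hpos
  have hnpos : (0 : ℝ) < n := by exact_mod_cast hn1
  have hcn : c / n ≤ ε := by
    rw [div_le_iff₀ hnpos]
    rw [div_lt_iff₀ hε] at hn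
    linarith [mul_comm ε (n : ℝ)]
  exact (h n hn1).trans (by linarith)

variable {P ν}

/-- **Decorrelation of decorated step functions** (the bilinear expansion).  If the decorrelation
bound holds for all pairs of measurable sets, then for two finite families of measurable sets
`T m ⊆ D`, `T' m ⊆ D'` (`m < n`) and constants `c, c' ≥ 0`,
`|E[H Σ_m c𝟙_{T m}(U) · H' Σ_m c'𝟙_{T' m}(U')] − E[H Σ c𝟙(U)] E[H' Σ c'𝟙(U')]| ≤ ζ (n c ν(D)) (n c' ν(D'))`.
[folklore] -/
theorem abs_integral_stepSum_sub_le {U U' : Ω → α} (hU : Measurable U) (hU' : Measurable U')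
    {H H' : Ω → ℝ} (hH : Measurable H) (hH' : Measurable H') (hH1 : ∀ ω, |H ω| ≤ 1)
    (hH'1 : ∀ ω, |H' ω| ≤ 1) {ζ : ℝ} (hζ : 0 ≤ ζ)
    (hdec : ∀ T T' : Set α, MeasurableSet T → MeasurableSet T' →
      |(∫ ω, H ω * T.indicator (fun _ => (1 : ℝ)) (U ω) * (H' ω * T'.indicator (fun _ => (1 : ℝ)) (U' ω)) ∂P) -
          (∫ ω, H ω * T.indicator (fun _ => (1 : ℝ)) (U ω) ∂P) *
            (∫ ω, H' ω * T'.indicator (fun _ => (1 : ℝ)) (U' ω) ∂P)| ≤ ζ * ν.real T * ν.real T')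
    {n : ℕ} {T T' : ℕ → Set α} (hT : ∀ m, MeasurableSet (T m)) (hT' : ∀ m, MeasurableSet (T' m))
    {D D' : Set α} (hTD : ∀ m, T m ⊆ D) (hT'D : ∀ m, T' m ⊆ D') {c c' : ℝ} (hc : 0 ≤ c) (hc' : 0 ≤ c') :
    |(∫ ω, H ω * (∑ m ∈ Finset.range n, c * (T m).indicator (fun _ => (1 : ℝ)) (U ω)) *
          (H' ω * ∑ m ∈ Finset.range n, c' * (T' m).indicator (fun _ => (1 : ℝ)) (U' ω)) ∂P) -
        (∫ ω, H ω * ∑ m ∈ Finset.range n, c * (T m).indicator (fun _ => (1 : ℝ)) (U ω) ∂P) *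
          (∫ ω, H' ω * ∑ m ∈ Finset.range n, c' * (T' m).indicator (fun _ => (1 : ℝ)) (U' ω) ∂P)|
      ≤ ζ * (n * c * ν.real D) * (n * c' * ν.real D') := by
  -- the elementary decorated indicators
  set X : ℕ → Ω → ℝ := fun m ω => H ω * (T m).indicator (fun _ => (1 : ℝ)) (U ω) with hX
  set Y : ℕ → Ω → ℝ := fun m ω => H' ω * (T' m).indicator (fun _ => (1 : ℝ)) (U' ω) with hY
  have hind1 : ∀ (S : Set α) (a : α), |S.indicator (fun _ => (1 : ℝ)) a| ≤ 1 := fun S a => by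
    by_cases h : a ∈ S
    · rw [Set.indicator_of_mem h, abs_one]
    · rw [Set.indicator_of_notMem h, abs_zero]; exact zero_le_one
  have hXm : ∀ m, Measurable (X m) := fun m => hH.mul ((measurable_const.indicator (hT m)).comp hU)
  have hYm : ∀ m, Measurable (Y m) := fun m => hH'.mul ((measurable_const.indicator (hT' m)).comp hU')
  have hX1 : ∀ m ω, |X m ω| ≤ 1 := fun m ω => by
    simp only [hX]; rw [abs_mul]
    exact mul_le_one₀ (hH1 ω) (abs_nonneg _) (hind1 _ _)
  have hY1 : ∀ m ω, |Y m ω| ≤ 1 := fun m ω => by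
    simp only [hY]; rw [abs_mul]
    exact mul_le_one₀ (hH'1 ω) (abs_nonneg _) (hind1 _ _)
  have hXint : ∀ m, Integrable (X m) P := fun m =>
    Integrable.of_bound (hXm m).aestronglyMeasurable 1 (ae_of_all _ fun ω => by
      rw [Real.norm_eq_abs]; exact hX1 m ω)
  have hYint : ∀ m, Integrable (Y m) P := fun m =>
    Integrable.of_bound (hYm m).aestronglyMeasurable 1 (ae_of_all _ fun ω => by
      rw [Real.norm_eq_abs]; exact hY1 m ω)
  have hXYint : ∀ m m', Integrable (fun ω => X m ω * Y m' ω) P := fun m m' =>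
    Integrable.of_bound ((hXm m).mul (hYm m')).aestronglyMeasurable 1 (ae_of_all _ fun ω => by
      rw [Real.norm_eq_abs, abs_mul]; exact mul_le_one₀ (hX1 m ω) (abs_nonneg _) (hY1 m' ω))
  -- rewrite the three integrands as finite sums
  have e1 : (fun ω => H ω * (∑ m ∈ Finset.range n, c * (T m).indicator (fun _ => (1 : ℝ)) (U ω)) *
      (H' ω * ∑ m ∈ Finset.range n, c' * (T' m).indicator (fun _ => (1 : ℝ)) (U' ω))) =
      fun ω => ∑ m ∈ Finset.range n, ∑ m' ∈ Finset.range n, c * c' * (X m ω * Y m' ω) := by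
    funext ω
    rw [Finset.mul_sum, Finset.mul_sum, Finset.sum_mul_sum]
    refine Finset.sum_congr rfl fun m _ => Finset.sum_congr rfl fun m' _ => ?_
    simp only [hX, hY]; ring
  have e2 : (fun ω => H ω * ∑ m ∈ Finset.range n, c * (T m).indicator (fun _ => (1 : ℝ)) (U ω)) =
      fun ω => ∑ m ∈ Finset.range n, c * X m ω := by
    funext ω
    simp only [hX, Finset.mul_sum]
    refine Finset.sum_congr rfl fun m _ => by ring
  have e3 : (fun ω => H' ω * ∑ m ∈ Finset.range n, c' * (T' m).indicator (fun _ => (1 : ℝ)) (U' ω)) =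
      fun ω => ∑ m ∈ Finset.range n, c' * Y m ω := by
    funext ω
    simp only [hY, Finset.mul_sum]
    refine Finset.sum_congr rfl fun m _ => by ring
  have i1 : ∫ ω, (∑ m ∈ Finset.range n, ∑ m' ∈ Finset.range n, c * c' * (X m ω * Y m' ω)) ∂P =
      ∑ m ∈ Finset.range n, ∑ m' ∈ Finset.range n, c * c' * ∫ ω, X m ω * Y m' ω ∂P := by
    rw [integral_finsetSum _ fun m _ => integrable_finsetSum _ fun m' _ => (hXYint m m').const_mul _]
    refine Finset.sum_congr rfl fun m _ => ?_
    rw [integral_finsetSum _ fun m' _ => (hXYint m m').const_mul _]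
    exact Finset.sum_congr rfl fun m' _ => integral_const_mul _ _
  have i2 : ∫ ω, (∑ m ∈ Finset.range n, c * X m ω) ∂P = ∑ m ∈ Finset.range n, c * ∫ ω, X m ω ∂P := by
    rw [integral_finsetSum _ fun m _ => (hXint m).const_mul _]
    exact Finset.sum_congr rfl fun m _ => integral_const_mul _ _
  have i3 : ∫ ω, (∑ m ∈ Finset.range n, c' * Y m ω) ∂P = ∑ m ∈ Finset.range n, c' * ∫ ω, Y m ω ∂P := by
    rw [integral_finsetSum _ fun m _ => (hYint m).const_mul _]
    exact Finset.sum_congr rfl fun m _ => integral_const_mul _ _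
  rw [e1, e2, e3, i1, i2, i3, Finset.sum_mul_sum, ← Finset.sum_sub_distrib]
  simp_rw [← Finset.sum_sub_distrib]
  -- each term
  have hterm : ∀ m m', |c * c' * ∫ ω, X m ω * Y m' ω ∂P - c * (∫ ω, X m ω ∂P) * (c' * ∫ ω, Y m' ω ∂P)|
      ≤ c * c' * (ζ * ν.real D * ν.real D') := by
    intro m m'
    rw [show c * c' * ∫ ω, X m ω * Y m' ω ∂P - c * (∫ ω, X m ω ∂P) * (c' * ∫ ω, Y m' ω ∂P) =
      c * c' * ((∫ ω, X m ω * Y m' ω ∂P) - (∫ ω, X m ω ∂P) * (∫ ω, Y m' ω ∂P)) by ring, abs_mul,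
      abs_of_nonneg (mul_nonneg hc hc')]
    refine mul_le_mul_of_nonneg_left ?_ (mul_nonneg hc hc')
    calc |(∫ ω, X m ω * Y m' ω ∂P) - (∫ ω, X m ω ∂P) * (∫ ω, Y m' ω ∂P)|
        ≤ ζ * ν.real (T m) * ν.real (T' m') := hdec (T m) (T' m') (hT m) (hT' m')
      _ ≤ ζ * ν.real D * ν.real D' :=
          mul_le_mul (mul_le_mul_of_nonneg_left (measureReal_mono (hTD m)) hζ)
            (measureReal_mono (hT'D m')) measureReal_nonneg (mul_nonneg hζ measureReal_nonneg)
  calc |∑ m ∈ Finset.range n, ∑ m' ∈ Finset.range n,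
          (c * c' * ∫ ω, X m ω * Y m' ω ∂P - c * (∫ ω, X m ω ∂P) * (c' * ∫ ω, Y m' ω ∂P))|
      ≤ ∑ m ∈ Finset.range n, ∑ m' ∈ Finset.range n,
          |c * c' * ∫ ω, X m ω * Y m' ω ∂P - c * (∫ ω, X m ω ∂P) * (c' * ∫ ω, Y m' ω ∂P)| :=
        (Finset.abs_sum_le_sum_abs _ _).trans (Finset.sum_le_sum fun m _ => Finset.abs_sum_le_sum_abs _ _)
    _ ≤ ∑ _m ∈ Finset.range n, ∑ _m' ∈ Finset.range n, c * c' * (ζ * ν.real D * ν.real D') :=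
        Finset.sum_le_sum fun m _ => Finset.sum_le_sum fun m' _ => hterm m m'
    _ = ζ * (n * c * ν.real D) * (n * c' * ν.real D') := by
        rw [Finset.sum_const, Finset.sum_const, Finset.card_range, nsmul_eq_mul, nsmul_eq_mul]; ring

/-- **Decorrelation extends from indicators to nonnegative bounded functions.**  If
`|E[H 𝟙_T(U) · H' 𝟙_{T'}(U')] − E[H 𝟙_T(U)] E[H' 𝟙_{T'}(U')]| ≤ ζ ν(T) ν(T')` for all measurable
`T, T'` (`|H|, |H'| ≤ 1`), then for measurable `0 ≤ f ≤ B`, `0 ≤ f' ≤ B'` supported in `D`, `D'`,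
`|E[H f(U) · H' f'(U')] − E[H f(U)] E[H' f'(U')]| ≤ ζ B B' ν(D) ν(D')`. [folklore] -/
theorem abs_integral_mul_sub_le_of_indicator {U U' : Ω → α} (hU : Measurable U)
    (hU' : Measurable U') {H H' : Ω → ℝ} (hH : Measurable H) (hH' : Measurable H')
    (hH1 : ∀ ω, |H ω| ≤ 1) (hH'1 : ∀ ω, |H' ω| ≤ 1) {ζ : ℝ} (hζ : 0 ≤ ζ)
    (hdec : ∀ T T' : Set α, MeasurableSet T → MeasurableSet T' →
      |(∫ ω, H ω * T.indicator (fun _ => (1 : ℝ)) (U ω) * (H' ω * T'.indicator (fun _ => (1 : ℝ)) (U' ω)) ∂P) -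
          (∫ ω, H ω * T.indicator (fun _ => (1 : ℝ)) (U ω) ∂P) *
            (∫ ω, H' ω * T'.indicator (fun _ => (1 : ℝ)) (U' ω) ∂P)| ≤ ζ * ν.real T * ν.real T')
    {f f' : α → ℝ} (hf : Measurable f) (hf' : Measurable f') {B B' : ℝ} (hB : 0 < B) (hB' : 0 < B')
    (hf0 : ∀ a, 0 ≤ f a) (hfB : ∀ a, f a ≤ B) (hf'0 : ∀ a, 0 ≤ f' a) (hf'B : ∀ a, f' a ≤ B')
    {D D' : Set α} (hfD : ∀ a, f a ≠ 0 → a ∈ D) (hf'D : ∀ a, f' a ≠ 0 → a ∈ D') :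
    |(∫ ω, H ω * f (U ω) * (H' ω * f' (U' ω)) ∂P) -
        (∫ ω, H ω * f (U ω) ∂P) * (∫ ω, H' ω * f' (U' ω) ∂P)| ≤ ζ * B * B' * ν.real D * ν.real D' := by
  set μ1 : ℝ := P.real Set.univ with hμ1
  have hμ1 : 0 ≤ μ1 := measureReal_nonneg
  refine le_of_forall_le_add_div (c := 2 * B * B' * (μ1 + μ1 * μ1)) (by positivity) fun n hn => ?_
  have hnpos : (0 : ℝ) < n := by exact_mod_cast hn
  -- resolution and level sets
  set δ : ℝ := B / n with hδ
  set δ' : ℝ := B' / n with hδ'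
  have hδ0 : 0 < δ := div_pos hB hnpos
  have hδ'0 : 0 < δ' := div_pos hB' hnpos
  have hnδ : (n : ℝ) * δ = B := by rw [hδ]; field_simp
  have hnδ' : (n : ℝ) * δ' = B' := by rw [hδ']; field_simp
  set T : ℕ → Set α := fun m => {a | ((m : ℝ) + 1) * δ ≤ f a} with hT
  set T' : ℕ → Set α := fun m => {a | ((m : ℝ) + 1) * δ' ≤ f' a} with hT'
  have hTm : ∀ m, MeasurableSet (T m) := fun m => measurableSet_le measurable_const hf
  have hT'm : ∀ m, MeasurableSet (T' m) := fun m => measurableSet_le measurable_const hf'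
  have hTD : ∀ m, T m ⊆ D := fun m a ha => hfD a (by
    have h1 : 0 < ((m : ℝ) + 1) * δ := by positivity
    exact (h1.trans_le ha).ne')
  have hT'D : ∀ m, T' m ⊆ D' := fun m a ha => hf'D a (by
    have h1 : 0 < ((m : ℝ) + 1) * δ' := by positivity
    exact (h1.trans_le ha).ne')
  -- the quantisations
  set fn : α → ℝ := fun a => ∑ m ∈ Finset.range n, δ * (T m).indicator (fun _ => (1 : ℝ)) a with hfn
  set fn' : α → ℝ := fun a => ∑ m ∈ Finset.range n, δ' * (T' m).indicator (fun _ => (1 : ℝ)) a with hfn'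
  have hfn_eq : ∀ a, fn a = ∑ m ∈ Finset.range n, if ((m : ℝ) + 1) * δ ≤ f a then δ else 0 := fun a =>
    Finset.sum_congr rfl fun m _ => by
      simp only [hT, Set.indicator_apply, Set.mem_setOf_eq, mul_ite, mul_one, mul_zero]
  have hfn'_eq : ∀ a, fn' a = ∑ m ∈ Finset.range n, if ((m : ℝ) + 1) * δ' ≤ f' a then δ' else 0 := fun a =>
    Finset.sum_congr rfl fun m _ => by
      simp only [hT', Set.indicator_apply, Set.mem_setOf_eq, mul_ite, mul_one, mul_zero]
  have hq : ∀ a, f a - δ ≤ fn a ∧ fn a ≤ f a := fun a => by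
    rw [hfn_eq]; exact sum_range_ite_le hδ0 (hf0 a) (by rw [hnδ]; exact hfB a)
  have hq' : ∀ a, f' a - δ' ≤ fn' a ∧ fn' a ≤ f' a := fun a => by
    rw [hfn'_eq]; exact sum_range_ite_le hδ'0 (hf'0 a) (by rw [hnδ']; exact hf'B a)
  -- the step-function bound
  have hstep := abs_integral_stepSum_sub_le hU hU' hH hH' hH1 hH'1 hζ hdec (n := n) hTm hT'm hTD hT'D
    hδ0.le hδ'0.le
  rw [hnδ, hnδ'] at hstep
  -- pointwise sizes
  have hXb : ∀ ω, |H ω * f (U ω)| ≤ B := fun ω => by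
    rw [abs_mul, abs_of_nonneg (hf0 _)]
    exact (mul_le_mul (hH1 ω) (hfB _) (hf0 _) zero_le_one).trans_eq (one_mul B)
  have hXnb : ∀ ω, |H ω * fn (U ω)| ≤ B := fun ω => by
    have h0 : 0 ≤ fn (U ω) := Finset.sum_nonneg fun m _ =>
      mul_nonneg hδ0.le (Set.indicator_nonneg (fun _ _ => zero_le_one) _)
    rw [abs_mul, abs_of_nonneg h0]
    exact (mul_le_mul (hH1 ω) ((hq _).2.trans (hfB _)) h0 zero_le_one).trans_eq (one_mul B)
  have hYb : ∀ ω, |H' ω * f' (U' ω)| ≤ B' := fun ω => by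
    rw [abs_mul, abs_of_nonneg (hf'0 _)]
    exact (mul_le_mul (hH'1 ω) (hf'B _) (hf'0 _) zero_le_one).trans_eq (one_mul B')
  have hYnb : ∀ ω, |H' ω * fn' (U' ω)| ≤ B' := fun ω => by
    have h0 : 0 ≤ fn' (U' ω) := Finset.sum_nonneg fun m _ =>
      mul_nonneg hδ'0.le (Set.indicator_nonneg (fun _ _ => zero_le_one) _)
    rw [abs_mul, abs_of_nonneg h0]
    exact (mul_le_mul (hH'1 ω) ((hq' _).2.trans (hf'B _)) h0 zero_le_one).trans_eq (one_mul B')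
  have hdX : ∀ ω, |H ω * f (U ω) - H ω * fn (U ω)| ≤ δ := fun ω => by
    rw [← mul_sub, abs_mul]
    refine (mul_le_mul (hH1 ω) ?_ (abs_nonneg _) zero_le_one).trans_eq (one_mul δ)
    rw [abs_le]; constructor <;> linarith [(hq (U ω)).1, (hq (U ω)).2]
  have hdY : ∀ ω, |H' ω * f' (U' ω) - H' ω * fn' (U' ω)| ≤ δ' := fun ω => by
    rw [← mul_sub, abs_mul]
    refine (mul_le_mul (hH'1 ω) ?_ (abs_nonneg _) zero_le_one).trans_eq (one_mul δ')
    rw [abs_le]; constructor <;> linarith [(hq' (U' ω)).1, (hq' (U' ω)).2]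
  -- measurability / integrability
  have hfnm : Measurable fn :=
    Finset.measurable_sum _ fun m _ => (measurable_const.indicator (hTm m)).const_mul _
  have hfn'm : Measurable fn' :=
    Finset.measurable_sum _ fun m _ => (measurable_const.indicator (hT'm m)).const_mul _
  have hXm : Measurable fun ω => H ω * f (U ω) := hH.mul (hf.comp hU)
  have hXnm : Measurable fun ω => H ω * fn (U ω) := hH.mul (hfnm.comp hU)
  have hYm : Measurable fun ω => H' ω * f' (U' ω) := hH'.mul (hf'.comp hU')
  have hYnm : Measurable fun ω => H' ω * fn' (U' ω) := hH'.mul (hfn'm.comp hU')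
  have hint : ∀ {g : Ω → ℝ} {C : ℝ}, Measurable g → (∀ ω, |g ω| ≤ C) → Integrable g P :=
    fun hg hgC => Integrable.of_bound hg.aestronglyMeasurable _
      (ae_of_all _ fun ω => by rw [Real.norm_eq_abs]; exact hgC ω)
  have hXYm : Measurable fun ω => H ω * f (U ω) * (H' ω * f' (U' ω)) := hXm.mul hYm
  have hXYnm : Measurable fun ω => H ω * fn (U ω) * (H' ω * fn' (U' ω)) := hXnm.mul hYnm
  have hXYb : ∀ ω, |H ω * f (U ω) * (H' ω * f' (U' ω))| ≤ B * B' := fun ω => by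
    rw [abs_mul]; exact mul_le_mul (hXb ω) (hYb ω) (abs_nonneg _) hB.le
  have hXYnb : ∀ ω, |H ω * fn (U ω) * (H' ω * fn' (U' ω))| ≤ B * B' := fun ω => by
    rw [abs_mul]; exact mul_le_mul (hXnb ω) (hYnb ω) (abs_nonneg _) hB.le
  -- the three differences
  have hd1 : |(∫ ω, H ω * f (U ω) * (H' ω * f' (U' ω)) ∂P) -
      ∫ ω, H ω * fn (U ω) * (H' ω * fn' (U' ω)) ∂P| ≤ (δ * B' + B * δ') * μ1 := by
    rw [← integral_sub (hint hXYm hXYb) (hint hXYnm hXYnb)]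
    refine abs_integral_le_mul_measureReal P fun ω => ?_
    calc |H ω * f (U ω) * (H' ω * f' (U' ω)) - H ω * fn (U ω) * (H' ω * fn' (U' ω))|
        ≤ |H ω * f (U ω) - H ω * fn (U ω)| * |H' ω * f' (U' ω)| +
            |H ω * fn (U ω)| * |H' ω * f' (U' ω) - H' ω * fn' (U' ω)| := abs_mul_sub_mul_le _ _ _ _
      _ ≤ δ * B' + B * δ' := add_le_add (mul_le_mul (hdX ω) (hYb ω) (abs_nonneg _) hδ0.le)
          (mul_le_mul (hXnb ω) (hdY ω) (abs_nonneg _) hB.le)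
  have hd3 : |(∫ ω, H ω * fn (U ω) ∂P) * (∫ ω, H' ω * fn' (U' ω) ∂P) -
      (∫ ω, H ω * f (U ω) ∂P) * (∫ ω, H' ω * f' (U' ω) ∂P)| ≤ (δ * B' + B * δ') * (μ1 * μ1) := by
    have ha : |(∫ ω, H ω * fn (U ω) ∂P) - ∫ ω, H ω * f (U ω) ∂P| ≤ δ * μ1 := by
      rw [← integral_sub (hint hXnm hXnb) (hint hXm hXb)]
      exact abs_integral_le_mul_measureReal P fun ω => by rw [abs_sub_comm]; exact hdX ω
    have hb : |(∫ ω, H' ω * fn' (U' ω) ∂P) - ∫ ω, H' ω * f' (U' ω) ∂P| ≤ δ' * μ1 := by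
      rw [← integral_sub (hint hYnm hYnb) (hint hYm hYb)]
      exact abs_integral_le_mul_measureReal P fun ω => by rw [abs_sub_comm]; exact hdY ω
    calc _ ≤ |(∫ ω, H ω * fn (U ω) ∂P) - ∫ ω, H ω * f (U ω) ∂P| * |∫ ω, H' ω * fn' (U' ω) ∂P| +
          |∫ ω, H ω * f (U ω) ∂P| * |(∫ ω, H' ω * fn' (U' ω) ∂P) - ∫ ω, H' ω * f' (U' ω) ∂P| :=
          abs_mul_sub_mul_le _ _ _ _
      _ ≤ δ * μ1 * (B' * μ1) + B * μ1 * (δ' * μ1) :=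
          add_le_add (mul_le_mul ha (abs_integral_le_mul_measureReal P hYnb) (abs_nonneg _) (by positivity))
            (mul_le_mul (abs_integral_le_mul_measureReal P hXb) hb (abs_nonneg _) (by positivity))
      _ = (δ * B' + B * δ') * (μ1 * μ1) := by ring
  -- assemble
  have hsum : (δ * B' + B * δ') * μ1 + (δ * B' + B * δ') * (μ1 * μ1) =
      2 * B * B' * (μ1 + μ1 * μ1) / n := by
    rw [hδ, hδ']; field_simp; ring
  calc |(∫ ω, H ω * f (U ω) * (H' ω * f' (U' ω)) ∂P) -
        (∫ ω, H ω * f (U ω) ∂P) * (∫ ω, H' ω * f' (U' ω) ∂P)|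
      ≤ |(∫ ω, H ω * f (U ω) * (H' ω * f' (U' ω)) ∂P) - ∫ ω, H ω * fn (U ω) * (H' ω * fn' (U' ω)) ∂P| +
        |(∫ ω, H ω * fn (U ω) * (H' ω * fn' (U' ω)) ∂P) -
            (∫ ω, H ω * fn (U ω) ∂P) * (∫ ω, H' ω * fn' (U' ω) ∂P)| +
        |(∫ ω, H ω * fn (U ω) ∂P) * (∫ ω, H' ω * fn' (U' ω) ∂P) -
            (∫ ω, H ω * f (U ω) ∂P) * (∫ ω, H' ω * f' (U' ω) ∂P)| :=
        (abs_sub_le _ _ _).trans (add_le_add (abs_sub_le _ _ _) le_rfl)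
    _ ≤ (δ * B' + B * δ') * μ1 + ζ * (B * ν.real D) * (B' * ν.real D') +
        (δ * B' + B * δ') * (μ1 * μ1) := add_le_add (add_le_add hd1 hstep) hd3
    _ = ζ * B * B' * ν.real D * ν.real D' + 2 * B * B' * (μ1 + μ1 * μ1) / n := by rw [← hsum]; ring

end Extension


end Literature.Probability.Moments

end
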